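import Summits.ValiantsHypothesis.ValiantsHypothesis.Theses.PrincipalMinorColouring

/-!
# Birth skeleton — piece B `ConstantEliminationQP` of the constants-seam split of `TotalRankNotQP`
(crux stmt-ValiantsHypothesis-3775, route PrincipalMinorColouring)

Piece B (scale-wise elimination of constants for determinantal representations of the permanent,
up to an integer multiplier, at quasi-polynomial cost): one exponent `a` such that an affine
determinantal representation of `per_n` of size `m` over `ℂ` yields `N ≠ 0` in `ℤ` and a
sign-constant circuit for `N · PER_n` over `ℤ` of size `≤ 2^((log₂ m + a)^a)`.

Three stubs and a genuine composition `ConstantEliminationQP_of`: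

* `stub_algebraicRepr` (M, provable-now: Hilbert's Nullstellensatz / Lefschetz — the variety of
  size-`m` affine determinantal representations of `per_n` is defined over `ℚ`, so a `ℂ`-point
  gives a `ℚ̄`-point; Mathlib `MvPolynomial.zeroLocus`/Nullstellensatz over `IsAlgClosed` plus
  faithful flatness of `ℚ̄ → ℂ`, or `FirstOrder.Language` completeness of `ACF₀`).
* `stub_lowDegreePoint` (THE BET, Diophantine/rigidity: some algebraic point of the size-`m`
  representation variety of `per_n` — or of a quasi-polynomially PADDED one — lives over a number
  field of quasi-polynomial DEGREE `≤ 2^((log₂ m + b)^b)`; generically the degree of a point is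
  only bounded by the degree of the variety, exponential in `m`; Grenet's point is rational at
  size `2^n - 1`, so the content sits exactly at `dc_ℂ(per_n) ≤ m < 2^{n^{o(1)}}`; route
  GaugeDescent's torus-orbit descent (Hilbert 90) is the candidate engine; uniqueness of optimal
  representations must NOT be used — refuted at `n = 3`, negatives index
  `GrenetRigidityOptimalUnique_refuted`).
* `stub_restrictionOfScalars` (L, provable-now: Berkowitz's division-free circuit for `det_m`
  over a number field `K` of degree `D`, `K`-arithmetic simulated on `ℚ^D` by the structure
  constants of an integral basis, denominators of the entries cleared into the multiplier `N`;
  output coordinate of `1` is `N · per_n` because `per_n ∈ ℚ[x]`).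
-/

set_option linter.dupNamespace false

namespace Summit.ValiantsHypothesis.ValiantsHypothesis.Cruxes.TotalRankNotQP.ConstantsSeam

open Literature.Computability.AlgebraicComplexity

/-- Piece B, verbatim the child statement `PrincipalMinorColouring.ConstantEliminationQP`. -/
def ConstantEliminationQP : Prop :=
  ∃ a : ℕ, ∀ n m : ℕ, Literature.Computability.AlgebraicComplexity.HasDetRepr (Literature.Computability.AlgebraicComplexity.perPoly (Fin n) ℂ) m → ∃ N : ℤ, N ≠ 0 ∧ Literature.Computability.AlgebraicComplexity.constantFreeComplexity (MvPolynomial.C N * Literature.Computability.AlgebraicComplexity.perPoly (Fin n) ℤ) ≤ 2 ^ ((Nat.log 2 m + a) ^ a)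

/-- stub (M, provable-now — Nullstellensatz/Lefschetz descent of one point): a complex affine
determinantal representation of `per_n` of size `m` yields one over `ℚ̄` of the same size. -/
theorem stub_algebraicRepr :
    ∀ n m : ℕ, HasDetRepr (perPoly (Fin n) ℂ) m →
      HasDetRepr (perPoly (Fin n) (AlgebraicClosure ℚ)) m := by
  sorry

/-- stub (THE BET — quasi-polynomial degree of some algebraic point on the qp-padded
representation variety): a `ℚ̄`-representation of size `m` yields, for one exponent `b` and all
`n, m`, a number field `K` of degree `≤ 2^((log₂ m + b)^b)` and a `K`-representation of size
`2^((log₂ m + b)^b)`. -/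
theorem stub_lowDegreePoint :
    ∃ b : ℕ, ∀ n m : ℕ, HasDetRepr (perPoly (Fin n) (AlgebraicClosure ℚ)) m →
      ∃ (K : Type) (_ : Field K) (_ : NumberField K),
        Module.finrank ℚ K ≤ 2 ^ ((Nat.log 2 m + b) ^ b) ∧
          HasDetRepr (perPoly (Fin n) K) (2 ^ ((Nat.log 2 m + b) ^ b)) := by
  sorry

/-- stub (L, provable-now — restriction of scalars on Berkowitz's circuit, denominators into
the multiplier): a representation of size `m` over a number field of degree `D` gives `N ≠ 0` and
a sign-constant circuit for `N · PER_n` over `ℤ` of size quasi-polynomial (indeed polynomial) in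
`m · D`. -/
theorem stub_restrictionOfScalars :
    ∃ a₀ : ℕ, ∀ (n m : ℕ) (K : Type) [Field K] [NumberField K],
      HasDetRepr (perPoly (Fin n) K) m →
        ∃ N : ℤ, N ≠ 0 ∧ constantFreeComplexity (MvPolynomial.C N * perPoly (Fin n) ℤ) ≤
          2 ^ ((Nat.log 2 (m * Module.finrank ℚ K) + a₀) ^ a₀) := by
  sorry

/-- Composition of two quasi-polynomial bounds at the level of exponents (as in the split glue
file): `t ≤ (L + c)^c ⟹ (t + a)^a ≤ (L + (c+2)(a+1))^{(c+2)(a+1)}`. [folklore] -/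
theorem qp_exponent_comp (a c L t : ℕ) (ht : t ≤ (L + c) ^ c) :
    (t + a) ^ a ≤ (L + (c + 2) * (a + 1)) ^ ((c + 2) * (a + 1)) := by
  set c' := (c + 2) * (a + 1) with hc'
  set u := L + c' with hu
  have hc'2 : 2 ≤ c' := by
    have : (c + 2) * (a + 1) ≥ (0 + 2) * (0 + 1) := Nat.mul_le_mul (by omega) (by omega)
    omega
  have hcc' : c ≤ c' := by
    have : (c + 2) * (a + 1) ≥ (c + 2) * 1 := Nat.mul_le_mul_left _ (by omega)
    omega
  have hac' : a ≤ c' := by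
    have : (c + 2) * (a + 1) ≥ 1 * (a + 1) := Nat.mul_le_mul_right _ (by omega)
    omega
  have hu2 : 2 ≤ u := le_add_left hc'2
  have hu1 : 1 ≤ u := le_trans (by norm_num) hu2
  have hLc : L + c ≤ u := Nat.add_le_add_left hcc' L
  have hau : a ≤ u := le_add_left hac'
  have h1 : t + a ≤ u ^ (c + 2) := by
    calc t + a ≤ (L + c) ^ c + a := Nat.add_le_add_right ht a
      _ ≤ u ^ c + u := Nat.add_le_add (Nat.pow_le_pow_left hLc c) hau
      _ ≤ u ^ (c + 1) + u ^ (c + 1) :=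
          Nat.add_le_add (Nat.pow_le_pow_right hu1 (Nat.le_succ c))
            (by simpa using Nat.pow_le_pow_right hu1 (show 1 ≤ c + 1 by omega))
      _ = 2 * u ^ (c + 1) := by ring
      _ ≤ u * u ^ (c + 1) := Nat.mul_le_mul_right _ hu2
      _ = u ^ (c + 2) := by ring
  calc (t + a) ^ a ≤ (u ^ (c + 2)) ^ a := Nat.pow_le_pow_left h1 a
    _ = u ^ ((c + 2) * a) := by rw [← pow_mul]
    _ ≤ u ^ c' := Nat.pow_le_pow_right hu1 (by rw [hc']; exact Nat.mul_le_mul_left _ (Nat.le_succ a))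

/-- `R ≤ 2^B ⟹ log₂ R ≤ B`. [folklore] -/
theorem log_two_le_of_le_two_pow {R B : ℕ} (hR : R ≤ 2 ^ B) : Nat.log 2 R ≤ B := by
  calc Nat.log 2 R ≤ Nat.log 2 (2 ^ B) := Nat.log_mono_right hR
    _ = B := Nat.log_pow (by norm_num) B

/-- Doubling inside a quasi-polynomial exponent: `2 (L + b)^b ≤ (L + (b + 2))^{b + 2}`. [folklore] -/
theorem two_mul_pow_le (L b : ℕ) : 2 * (L + b) ^ b ≤ (L + (b + 2)) ^ (b + 2) := by
  have h1 : (L + b) ^ b ≤ (L + (b + 2)) ^ b := Nat.pow_le_pow_left (by omega) b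
  have h2 : 1 ≤ L + (b + 2) := by omega
  calc 2 * (L + b) ^ b ≤ (L + (b + 2)) * (L + (b + 2)) ^ b :=
        Nat.mul_le_mul (by omega) h1
    _ = (L + (b + 2)) ^ (b + 1) := by ring
    _ ≤ (L + (b + 2)) ^ (b + 2) := Nat.pow_le_pow_right h2 (by omega)

/-- **Composition** `ConstantEliminationQP_of`: B from the three stubs. From a `ℂ`-representation
of size `m`: a `ℚ̄`-one of size `m` (stub 1); a number field `K` of degree `D ≤ 2^t` and a
`K`-representation of size `2^t`, `t = (log₂ m + b)^b` (stub 2); `N ≠ 0` with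
`τ(N · PER_n) ≤ 2^((log₂(2^t · D) + a₀)^{a₀}) ≤ 2^((2t + a₀)^{a₀})` (stub 3); and
`2t ≤ (log₂ m + b + 2)^{b+2}` makes this `≤ 2^((log₂ m + a)^a)` with `a = (b+4)(a₀+1)`. -/
theorem ConstantEliminationQP_of
    (h₁ : ∀ n m : ℕ, HasDetRepr (perPoly (Fin n) ℂ) m →
      HasDetRepr (perPoly (Fin n) (AlgebraicClosure ℚ)) m)
    (h₂ : ∃ b : ℕ, ∀ n m : ℕ, HasDetRepr (perPoly (Fin n) (AlgebraicClosure ℚ)) m →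
      ∃ (K : Type) (_ : Field K) (_ : NumberField K),
        Module.finrank ℚ K ≤ 2 ^ ((Nat.log 2 m + b) ^ b) ∧
          HasDetRepr (perPoly (Fin n) K) (2 ^ ((Nat.log 2 m + b) ^ b)))
    (h₃ : ∃ a₀ : ℕ, ∀ (n m : ℕ) (K : Type) [Field K] [NumberField K],
      HasDetRepr (perPoly (Fin n) K) m →
        ∃ N : ℤ, N ≠ 0 ∧ constantFreeComplexity (MvPolynomial.C N * perPoly (Fin n) ℤ) ≤
          2 ^ ((Nat.log 2 (m * Module.finrank ℚ K) + a₀) ^ a₀)) :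
    ConstantEliminationQP := by
  obtain ⟨b, hb⟩ := h₂
  obtain ⟨a₀, ha₀⟩ := h₃
  refine ⟨(b + 2 + 2) * (a₀ + 1), fun n m hm => ?_⟩
  -- descent to `ℚ̄`, then to a number field of qp degree with a qp-padded representation
  obtain ⟨K, instF, instNF, hD, hK⟩ := hb n m (h₁ n m hm)
  -- restriction of scalars + denominators
  obtain ⟨N, hN, hτ⟩ := ha₀ n (2 ^ ((Nat.log 2 m + b) ^ b)) K hK
  refine ⟨N, hN, hτ.trans (Nat.pow_le_pow_right (by norm_num) ?_)⟩
  -- exponent arithmetic: with `t = (log₂ m + b)^b`, `log₂(2^t · D) ≤ 2t ≤ (log₂ m + (b+2))^{b+2}`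
  set t := (Nat.log 2 m + b) ^ b with ht
  have hprod : 2 ^ t * Module.finrank ℚ K ≤ 2 ^ (2 * t) := by
    calc 2 ^ t * Module.finrank ℚ K ≤ 2 ^ t * 2 ^ t := Nat.mul_le_mul_left _ hD
      _ = 2 ^ (2 * t) := by rw [← pow_add, two_mul]
  have hlog : Nat.log 2 (2 ^ t * Module.finrank ℚ K) ≤ (Nat.log 2 m + (b + 2)) ^ (b + 2) :=
    (log_two_le_of_le_two_pow hprod).trans (two_mul_pow_le (Nat.log 2 m) b)
  exact qp_exponent_comp a₀ (b + 2) (Nat.log 2 m) _ hlog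

end Summit.ValiantsHypothesis.ValiantsHypothesis.Cruxes.TotalRankNotQP.ConstantsSeam
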